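import Mathlib
import HarnessLib
import Summits.HubbardSuperconductivity.HubbardSuperconductivity.Theorems.KLProgrammeKLRegimeTwoVolumeTowerBaseGridLimit
import Summits.HubbardSuperconductivity.HubbardSuperconductivity.Theorems.KLProgrammeKLRegimeTwoVolumeTowerGenericFacts

/-!
# Route `KLProgramme` — crux K3, VL child `KLRegimeVolumeLimitV17F2` (stmt-HubbardSuperconductivity-20440), blueprint v5 M5 / W4 (canonical radii): THE BASE
# FIELD `h0` OF `TowerData β U μ` AT THE CANONICAL RADII (seat hubbard-kl-k3c4-p1 g13; `--supports` 20440)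

`…TowerBaseGridLimit.towerData_h0_of_baseData` with the canonical choices substituted: pin radius `r L = L / (4·n_β + 7)` (the fields `r, hr, hRd` of `TowerData`,
`…TowerGenericFacts.tower_radius_tendsto / _deep`), grid radii `R = √r`, `R′ = r − √r` (`…TowerGenericFacts.tower_radii_sqrt`).  What remains for the dischargers is
data only: the base-transfer bundle, the grid bundle `TowerGridData` at `(R, R′)`, and six rates tending to zero.

* **`towerData_h0_canonical`**.

Proofs only; no definition.
-/

noncomputable section

namespace Summit.HubbardSuperconductivity.HubbardSuperconductivity.Theorems.TwoVolumeSource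

set_option linter.dupNamespace false -- summit = problem name (single-conjunct summit), D-0017

open Finset Filter Topology Literature.MathematicalPhysics.QuantumLattice GrassmannAlgebra Literature.Probability.LatticeModels
  Literature.Probability.LatticeModels.BattleFederbush
open Literature.MathematicalPhysics.QuantumLattice.FermiRG
open Summit.HubbardSuperconductivity.HubbardSuperconductivity.Theorems.KLProgrammeLegKernels
open Summit.HubbardSuperconductivity.HubbardSuperconductivity.Theorems.KLRegimeSplit
open Summit.HubbardSuperconductivity.HubbardSuperconductivity.Theorems.TwoPointAssembly
open Summit.HubbardSuperconductivity.HubbardSuperconductivity.Theorems.EngineV8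
open Summit.HubbardSuperconductivity.HubbardSuperconductivity.Theorems.TwoVolumeDefect

/-- **THE BASE FIELD `h0` OF `TowerData β U μ` AT THE CANONICAL RADII** (see the module docstring). [folklore] -/
theorem towerData_h0_canonical (β U μ : ℝ) (hβ : 0 < β) (Mth : ℕ → ℕ → ℕ)
    (hMth : ∀ L b M, Mth L b ≤ M → 0 < imagTimeWeight β M ∧ imagTimeWeight β M ≤ 1)
    -- the base-transfer data of `…TowerBase`
    {ΛT cW Λg δb : ℝ} (hΛT : 0 < ΛT) (hcW : 0 ≤ cW) (hΛg : 0 < Λg) (NG : ℕ → ℝ) (hNG0 : ∀ k, 0 ≤ NG k)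
    (δ : ℕ → ℝ) (hδ : ∀ L, 0 ≤ δ L ∧ δ L ≤ δb) (hδ0 : Tendsto δ atTop (𝓝 0))
    (hdataT : ∀ᶠ L in atTop, ∀ (b M : ℕ) [NeZero L] [NeZero (b * L)] [NeZero M], Mth L b ≤ M →
      (∀ x : SrcLabel (b * L) M 0, ∑ y, ‖klBaseTransfer (b * L) M β μ (klFlowFrameU L M β U μ (nScales β + 1)) x y‖ * (1 + ΛT * (Torus.tnorm (x.1.1.2 - y.1.1.1.2) : ℝ)) ≤ cW) ∧
      (∀ y : GridLeg (GridPoint (b * L) (klGridN M)) × Fin 2, ∑ x, ‖klBaseTransfer (b * L) M β μ (klFlowFrameU L M β U μ (nScales β + 1)) x y‖ * (1 + ΛT * (Torus.tnorm (x.1.1.2 - y.1.1.1.2) : ℝ)) ≤ cW) ∧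
      (∀ (δ' β' β₁ : Fin 2 → Fin b) (xbar : SrcLabel L M 0) (y : GridLeg (GridPoint L (klGridN M)) × Fin 2),
        ‖klBaseTransfer (b * L) M β μ (klFlowFrameU L M β U μ (nScales β + 1)) ((klBlockEquivD L b M 0).symm (β' + δ', xbar)) ((klGridBlockEquivD L b M).symm (β₁ + δ', y))‖ =
          ‖klBaseTransfer (b * L) M β μ (klFlowFrameU L M β U μ (nScales β + 1)) ((klBlockEquivD L b M 0).symm (β', xbar)) ((klGridBlockEquivD L b M).symm (β₁, y))‖) ∧
      (∀ x, ∑ y, ‖klBaseTransfer (b * L) M β μ (klFlowFrameU (b * L) M β U μ (nScales β + 1)) x y - klBaseTransfer (b * L) M β μ (klFlowFrameU L M β U μ (nScales β + 1)) x y‖ ≤ δ L) ∧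
      (∀ y, ∑ x, ‖klBaseTransfer (b * L) M β μ (klFlowFrameU (b * L) M β U μ (nScales β + 1)) x y - klBaseTransfer (b * L) M β μ (klFlowFrameU L M β U μ (nScales β + 1)) x y‖ ≤ δ L) ∧
      (∀ (k : ℕ) (p : Fin k) (y : GridLeg (GridPoint L (klGridN M))),
        ∑ Y ∈ univ.filter (fun Y : Fin k → GridLeg (GridPoint L (klGridN M)) => Y p = y),
          ‖kernel ℂ (klGridAction L M β U μ (klFlowFrameU L M β U μ (nScales β + 1))) k Y‖ *
            (1 + labelDiam (fun Y₁ Y₂ : GridLeg (GridPoint L (klGridN M)) => Λg * (Torus.tnorm (Y₁.1.1.2 - Y₂.1.1.2) : ℝ)) (univ.image Y)) ≤ imagTimeWeight β M * NG k) ∧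
      (∀ (k : ℕ) (p : Fin k) (y : GridLeg (GridPoint (b * L) (klGridN M))),
        ∑ Y ∈ univ.filter (fun Y : Fin k → GridLeg (GridPoint (b * L) (klGridN M)) => Y p = y),
          ‖kernel ℂ (klGridAction (b * L) M β U μ (klFlowFrameU (b * L) M β U μ (nScales β + 1))) k Y‖ *
            (1 + labelDiam (fun Y₁ Y₂ : GridLeg (GridPoint (b * L) (klGridN M)) => Λg * (Torus.tnorm (Y₁.1.1.2 - Y₂.1.1.2) : ℝ)) (univ.image Y)) ≤ imagTimeWeight β M * NG k))
    -- the grid data of `tower_base_grid_keyedDefect_eventually_le`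
    {κE αC cb κ κ' ρS ρ' ρ₂ ρf αw α α' m₁ m₁' s s' Θ νW νf ν₂ νD : ℝ}
    (hκE : 0 < κE) (hαC : 0 < αC) (hκ : 0 < κ) (hκ' : 0 < κ') (hρS : 0 < ρS) (hρ' : 0 < ρ') (hρ₂ : 0 < ρ₂) (hρf : 0 < ρf) (hαw : 0 < αw)
    (hαα : 0 < α' + α) (hm0 : 0 ≤ m₁) (hm0' : 0 ≤ m₁') (hs0 : 0 ≤ s) (hs'0 : 0 ≤ s') (hνW0 : 0 ≤ νW) (hνf0 : 0 ≤ νf) (hν₂0 : 0 ≤ ν₂)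
    (hθS : Real.exp 1 * (αC + cb) * νW / κE ^ 2 < 1) (hθΘ : Real.exp 1 * αw * Θ / κ' ^ 2 < 1)
    (hθf : Real.exp 1 * (α' + α + (m₁' + m₁)) * νf / (κ' + κ) ^ 2 < 1) (hθ₂ : Real.exp 1 * (α' + α + (m₁' + m₁)) * ν₂ / (κ' + κ + (κ' + κ + (κ' + κ))) ^ 2 < 1)
    (sE cR cC eE T Te : ℕ → ℝ)
    (hrate : ∀ L, 0 ≤ sE L ∧ 0 ≤ cR L ∧ 0 ≤ cC L ∧ cR L + cC L ≤ cb ∧ 0 < T L ∧ 0 ≤ Te L)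
    (hsE0 : Tendsto sE atTop (𝓝 0)) (hcR0 : Tendsto cR atTop (𝓝 0)) (hcC0 : Tendsto cC atTop (𝓝 0)) (heE0 : Tendsto eE atTop (𝓝 0))
    (hT0 : Tendsto T atTop (𝓝 0)) (hTe0 : Tendsto Te atTop (𝓝 0))
    (hdata : ∀ᶠ L in atTop, ∀ (b M : ℕ) [NeZero L] [NeZero (b * L)] [NeZero M], Mth L b ≤ M →
      Nonempty (TowerGridData L b M β U μ (klFlowFrameU L M β U μ (nScales β + 1)) (klFlowFrameU (b * L) M β U μ (nScales β + 1)) (imagTimeWeight β M) κE αC κ κ' ρS ρ' ρ₂ ρf αw α α' m₁ m₁' s s' Θ νW νf ν₂ νD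
        (sE L) (cR L) (cC L) (eE L) (T L) (Te L) (Nat.sqrt (L / (4 * nScales β + 7))) ((L / (4 * nScales β + 7)) - Nat.sqrt (L / (4 * nScales β + 7))))) :
    ∀ (k : ℕ) (η : ℝ), 0 < η → ∀ᶠ L in atTop, ∀ (b M : ℕ) [NeZero L] [NeZero (b * L)] [NeZero M], Mth L b ≤ M →
      ∀ (p : Fin k) (w : SrcLabel (b * L) M 0), (∀ i, 2 * (L / (4 * nScales β + 7)) ≤ (w.1.1.2 i).val % L ∧ (w.1.1.2 i).val % L + 2 * (L / (4 * nScales β + 7)) < L) →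
        klKeyedDefect L b M β U μ (klFlowFrameU L M β U μ (nScales β + 1)) (klFlowFrameU (b * L) M β U μ (nScales β + 1)) 0 k p w ≤ imagTimeWeight β M * η := by
  obtain ⟨hRR, hq0, hq'0, -⟩ := tower_radii_sqrt (fun L : ℕ => L / (4 * nScales β + 7)) (tower_radius_tendsto β)
  exact towerData_h0_of_baseData β U μ hβ Mth hMth (fun L => L / (4 * nScales β + 7)) (tower_radius_tendsto β) hΛT hcW hΛg NG hNG0 δ hδ hδ0
    hdataT hκE hαC hκ hκ' hρS hρ' hρ₂ hρf hαw hαα hm0 hm0' hs0 hs'0 hνW0 hνf0 hν₂0 hθS hθΘ hθf hθ₂ sE cR cC eE T Te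
    (fun L => Nat.sqrt (L / (4 * nScales β + 7))) (fun L => L / (4 * nScales β + 7) - Nat.sqrt (L / (4 * nScales β + 7))) hrate hsE0 hcR0 hcC0 heE0
    hT0 hTe0 hq0 hq'0 hRR hdata

end Summit.HubbardSuperconductivity.HubbardSuperconductivity.Theorems.TwoVolumeSource

end
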